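import Summits.QuantumFields.YangMills.Theorems.IR.BlockedActivityWSharp
import HarnessLib

/-!
# Crux `IR` (stmt-QuantumFields-19354), lane B «strong coupling AFTER BLOCKING»: the strong-coupling calibration at EVERY mesh

Helper module for item `stmt-QuantumFields-19354` (`--supports`; it closes nothing), lane `ym-19354-onsetsc-p2` (g2).

THE QUESTION.  The class of record of the activity axis (THE NUMBER §A‴), `BlockedActivityClassW ρ β b n a` (p536391), is
quantified over an arbitrary mesh `b`, and the weak-side construction statements (`BlockedActivityTypOnsetCalSCWTol`, p538172)
ask for SOME mesh `b(β) → ∞`; but the only certified inhabitant so far is the mesh-`1` calibration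
`blockedActivityClassW_one_of_smallBeta` (p531838 ∕ p536391).  Is the typed class satisfiable at `b > 1` at all, and how does
its strong-coupling window depend on `b`?

THE ANSWER (this file).  The mesh-`1` Wilson representation of `Theorems/IR/BlockedActivityCalibrationCells` (product Haar
reference on the links of the region, cell σ-algebras generated by the links of the FORWARD neighbours, cell factor of `c` =
`∏_{p based in c} e^{-β s_p} − 1`) is a blocked local-perturbation representation at EVERY mesh `b ≥ 1`: all its lemmas use
only the lower frame bound `w i j + 1 ≤ w i (j+1)`, and the single mesh-dependent input is the count of plaquettes based in
one cell, `≤ (2b)⁴ · 6 = 96 · b⁴` (`card_Pcell_le_mesh`).  Hence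

* `nonempty_blockedRep_mesh` — the representation at mesh `b` for `96 b⁴ · |β| (N + C_ρ) ≤ A ≤ 1`, `2A ≤ a`;
* **`blockedActivityClass_of_mesh_threshold`** — the EXPLICIT threshold: `|plaquetteObs ρ| ≤ C`, `a ≤ 2` and
  `96 · b⁴ · |β| · (N + C) ≤ a ∕ 2` put the Wilson kernels in `BlockedActivityClass ρ β b n a` (hence in the W-class) at every
  window `n` — the strong window of the class CLOSES LIKE `b⁻⁴`;
* `blockedActivityClassW_of_smallBeta_mesh` — `∀ b ≥ 1, ∃ β_B > 0, ∀ |β| ≤ β_B, ∀ n, BlockedActivityClassW ρ β b n a`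
  (THE NUMBER §A‴ (3) «strong end» at every mesh, not only at mesh `1`);
* `blockedActivityClassW_of_beta_mul_pow_four_le` — the same with ONE constant: `∃ κ > 0, ∀ b ≥ 1, ∀ β, |β| · b⁴ ≤ κ → ∀ n, …`;
* `univShellCond_of_smallBeta_mesh` — consequently `OnsetFormats.UnivShellCond ρ β b n ε` at every mesh and window for
  `|β| · b⁴ ≤ κ(ε)` (through the lane's KP-grade reduction `univShellCond_of_blockedActivityW_sharp`, p538158).

WHAT THE NUMBER SAYS (census sentence).  Re-indexing the lattice into mesh-`b` cells keeps the Wilson kernels inside the activity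
ball of radius `a` exactly as long as `|β| ≲ a ∕ (192 · b⁴ · (N + C_ρ))`: the window SHRINKS with the mesh.  So the weak-side
statement (class of radius `radiusT ε` at a mesh `b(β) → ∞` for all large `β`) can never be met by re-indexing — the located
gap of the lane is an INTEGRATING-OUT dictionary (an effective reference measure per window datum whose inter-cell factors are
small BECAUSE `b ≳ ξ(β)`), not a choice of cells.  This file certifies the trivial direction and its rate, nothing more.

HONEST FRAMING: strong-coupling bookkeeping; nothing here is about weak coupling, the onset, mixing, a gap or Clay.
No `sorry`; axioms ⊆ {propext, Classical.choice, Quot.sound}; no instances, no notation.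
Refs: OsterwalderSeilerAnnPhys1978 §3; SeilerLNP1982 Ch. 2; FriedliVelenik2017 §5.7.1 (the input format).
-/

set_option autoImplicit false

noncomputable section

open MeasureTheory ProbabilityTheory
open Literature.MathematicalPhysics.QuantumFieldTheory (haarProbability)
open Literature.MathematicalPhysics.QuantumLattice
open Literature.Probability.LatticeModels (IsLocalPerturbation IsLocalObservable pertExpect pertNum pertZ Touches glueWith
  glueWith_apply_mem glueWith_apply_not_mem measurable_glueWith)
open Summit.QuantumFields.YangMills.Cruxes.IR.Tempered (cellEdges windowCells regionEdges
  integral_ymSpecification_of_continuous)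
open Summit.QuantumFields.YangMills.Cruxes.IR.CellTempered.Engine (frameCell frameCell_eq_iff)
open Summit.QuantumFields.YangMills.Cruxes.IR.OnsetFormats (UnivShellCond)
open Summit.QuantumFields.YangMills.Cruxes.IR.AfPincerUc (IsFrame)

namespace Summit.QuantumFields.YangMills.Cruxes.IR.BlockedActivity

/-! ## §1 The one mesh-dependent input: plaquettes based in a mesh-`b` cell -/

section Counting

variable {w : Fin 4 → ℤ → ℤ} {b : ℕ} (Λ : Finset (ZdEdge 4))

/-- The mesh-`1` constant of `Theorems/IR/BlockedActivityCalibration` is `96` (`16` base points × `6` planes; the plane count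
`Fintype.card {q : Fin 4 × Fin 4 // q.1 < q.2} = 6` is `CurvatureBoostCovariance.Negative.card_planes` in the tree, re-decided
inline here to keep this module's imports inside lane B). -/
theorem cellPlaqBound_eq : cellPlaqBound = 96 := by
  unfold cellPlaqBound; decide

/-- The lower frame bound of a mesh-`b` frame, `b ≥ 1`. -/
theorem frame_lower_of_isFrame (hw : IsFrame b w) (hb : 1 ≤ b) : ∀ i j, w i j + 1 ≤ w i (j + 1) := fun i j => by
  have := (hw i j).1
  have hb' : (1 : ℤ) ≤ (b : ℤ) := by exact_mod_cast hb
  omega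

/-- **A mesh-`b` cell is the base cell of at most `96 · b⁴` plaquettes** (`(2b)⁴` base points × `6` planes). -/
theorem card_Pcell_le_mesh (hw : IsFrame b w) (hb : 1 ≤ b) (c : Cell) : (Pcell w Λ c).card ≤ 96 * b ^ 4 := by
  have hw1 := frame_lower_of_isFrame hw hb
  set box : Finset (Fin 4 → ℤ) := Fintype.piFinset fun i => Finset.Ico (w i (c i)) (w i (c i + 1)) with hbox
  have hsub : Pcell w Λ c ⊆ box ×ˢ (Finset.univ : Finset {q : Fin 4 × Fin 4 // q.1 < q.2}) := by
    intro p hp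
    have hpc : baseCell w p = c := (Finset.mem_filter.1 hp).2
    have hmem : (p.1, p.2.1.1) ∈ cellEdges w c := (frameCell_eq_iff hw1 _ c).1 hpc
    have hx : p.1 ∈ box := (Finset.mem_product.1 hmem).1
    exact Finset.mem_product.2 ⟨hx, Finset.mem_univ _⟩
  have hboxc : box.card ≤ (2 * b) ^ 4 := by
    rw [hbox, Fintype.card_piFinset]
    have h : ∀ i : Fin 4, (Finset.Ico (w i (c i)) (w i (c i + 1))).card ≤ 2 * b := fun i => by
      rw [Int.card_Ico]
      refine Int.toNat_le.2 ?_
      have := (hw i (c i)).2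
      push_cast at this ⊢
      omega
    have := Finset.prod_le_pow_card (Finset.univ : Finset (Fin 4))
      (fun i => (Finset.Ico (w i (c i)) (w i (c i + 1))).card) (2 * b) fun i _ => h i
    simpa using this
  calc (Pcell w Λ c).card ≤ (box ×ˢ (Finset.univ : Finset {q : Fin 4 × Fin 4 // q.1 < q.2})).card :=
        Finset.card_le_card hsub
    _ = box.card * Fintype.card {q : Fin 4 × Fin 4 // q.1 < q.2} := by
        rw [Finset.card_product, Finset.card_univ]
    _ ≤ (2 * b) ^ 4 * 6 := by
        have h6 : Fintype.card {q : Fin 4 × Fin 4 // q.1 < q.2} = 6 := by decide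
        rw [h6]; exact Nat.mul_le_mul_right _ hboxc
    _ = 96 * b ^ 4 := by ring

end Counting

/-! ## §2 The Wilson representation at mesh `b` -/

section Construction

variable {G : Type} [Group G] [TopologicalSpace G] [IsTopologicalGroup G] [CompactSpace G]
  [MeasurableSpace G] [BorelSpace G] {N : ℕ} (ρ : G →* Matrix (Fin N) (Fin N) ℂ) (β : ℝ)
  {w : Fin 4 → ℤ → ℤ} {b : ℕ}

/-- **The Wilson representation is a blocked local-perturbation representation at EVERY mesh `b ≥ 1`.**  For
`|plaquetteObs| ≤ C`, `96 b⁴ · |β| (N + C) ≤ A ≤ 1` and `2A ≤ a`: reference = product Haar on the links of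
`Λ = regionEdges w Y`, cell σ-algebras generated by the links of the forward neighbours, cell factor of `c` =
`∏_{p based in c} e^{-β s_p} − 1`, centre observables realised by gluing — verbatim the mesh-`1` construction
`nonempty_blockedRep` (p531838) with the mesh-`b` count `card_Pcell_le_mesh`. -/
theorem nonempty_blockedRep_mesh (hw : IsFrame b w) (hb : 1 ≤ b) (hρ : Continuous ρ) {C : ℝ}
    (hC : ∀ (x : Fin 4 → ℤ) (i j : Fin 4) (U : LGConfig 4 G), |plaquetteObs ρ x i j U| ≤ C)
    {A a : ℝ} (hA : ((96 * b ^ 4 : ℕ) : ℝ) * (|β| * ((N : ℝ) + C)) ≤ A) (hA1 : A ≤ 1) (ha : 2 * A ≤ a)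
    (Y : Finset Cell) (h0 : (0 : Cell) ∈ Y) : Nonempty (BlockedRep ρ β w Y a) := by
  have hw1 := frame_lower_of_isFrame hw hb
  set Λ := regionEdges w Y with hΛ
  have hΛ0 : ∀ e ∈ cellEdges w 0, e ∈ Λ := fun e he => Finset.mem_biUnion.2 ⟨0, h0, he⟩
  have hE0 : ∀ e (he : e ∈ cellEdges w 0), (⟨e, hΛ0 e he⟩ : ↥Λ) ∈ Ecell w Λ 0 := fun e he => by
    refine Finset.mem_filter.2 ⟨Finset.mem_univ _, ?_⟩
    rw [(frameCell_eq_iff hw1 e 0).2 he]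
    exact fun i => ⟨le_rfl, by simp⟩
  have ha0 : 0 ≤ a := by
    have : 0 ≤ ((96 * b ^ 4 : ℕ) : ℝ) * (|β| * ((N : ℝ) + C)) := by
      have : 0 ≤ C := (abs_nonneg _).trans (hC 0 0 0 fun _ => 1)
      positivity
    linarith
  refine ⟨{
    Ω := ↥Λ → G
    mΩ := MeasurableSpace.pi
    μ := Measure.pi fun _ : ↥Λ => haarProbability G
    isProb := inferInstance
    𝓕 := cellSigma w Λ
    C := Ccells w Λ
    g := cellFactor ρ β w Λ
    obs := obsReal Λ
    perturbation := fun σ => {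
      le := cellSigma_le w Λ
      indep := indep_cellSigma Λ
      measurable := fun c => measurable_cellFactor ρ β Λ hw1 hρ σ c
      norm_le := fun c ζ => (norm_cellFactor_le ρ β Λ hC (card_Pcell_le_mesh Λ hw hb) hA hA1 σ c ζ).trans ha
      nonneg := ha0 }
    obs_local := fun f hf => ?_
    local_g := fun p σ σ' h => cellFactor_local ρ β hw1 p σ σ' h
    rep := fun σ f hf => ?_ }⟩
  · -- locality and boundedness of the realised observable
    refine ⟨?_, fun ζ => ?_⟩
    · have hm : Measurable[cellSigma (G := G) w Λ 0] (obsReal Λ f) := by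
        refine measurable_cellSigma_of_factor w Λ 0
          (Ft := fun ξ => ((f (glueWith Λ (ext w Λ 0 ξ) fun _ => 1) : ℝ) : ℂ)) ?_ fun ζ => ?_
        · exact Complex.measurable_ofReal.comp (hf.2.1.comp ((measurable_glueWith Λ _).comp (measurable_ext w Λ 0)))
        · unfold obsReal
          congr 1
          refine hf.1 fun e he => ?_
          have he' : e ∈ cellEdges w 0 := he
          rw [glueWith_apply_mem _ _ _ (hΛ0 e he'), glueWith_apply_mem _ _ _ (hΛ0 e he'),
            ext_restr_apply w Λ 0 ζ (hE0 e he')]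
      exact hm.mono (le_iSup₂ (f := fun (p : Cell) (_ : p ∈ ({0} : Finset Cell)) => cellSigma (G := G) w Λ p) 0
        (Finset.mem_singleton_self 0)) le_rfl
    · unfold obsReal
      rw [Complex.norm_real, Real.norm_eq_abs]
      obtain ⟨h0f, h1f⟩ := hf.2.2 (glueWith Λ ζ fun _ => 1)
      rw [abs_of_nonneg h0f]; exact h1f
  · -- the representation: tilted product Haar = perturbed expectation
    have hobs : ∀ ζ : ↥Λ → G, obsReal Λ f ζ = ((f (glueWith Λ ζ σ) : ℝ) : ℂ) := fun ζ => by
      unfold obsReal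
      congr 1
      refine hf.1 fun e he => ?_
      have he' : e ∈ cellEdges w 0 := he
      rw [glueWith_apply_mem _ _ _ (hΛ0 e he'), glueWith_apply_mem _ _ _ (hΛ0 e he')]
    rw [integral_ymSpecification_of_continuous ρ hρ β Λ hf.2.1 σ, Complex.ofReal_div]
    show _ = pertNum _ _ _ _ / pertZ _ _ _
    unfold pertNum pertZ
    congr 1
    · rw [← integral_complex_ofReal]
      congr 1
      funext ζ
      rw [hobs, prod_one_add_cellFactor]
      push_cast
      ring
    · rw [← integral_complex_ofReal]
      congr 1
      funext ζ
      rw [prod_one_add_cellFactor]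

/-! ## §3 The calibration at every mesh: explicit threshold, existential window, one constant -/

/-- **EXPLICIT THRESHOLD — the `b⁻⁴` law.**  If `|plaquetteObs ρ| ≤ C`, `0 ≤ a ≤ 2` and
`96 · b⁴ · |β| · (N + C) ≤ a ∕ 2`, then the Wilson kernels of every cell region of every window of every mesh-`b` frame are in
the blocked-activity class of radius `a`: `BlockedActivityClass ρ β b n a` for all `n`.  The admissible `|β|` shrinks like
`b⁻⁴` — re-indexing into coarser cells LEAVES the activity ball; it never enters it. -/
theorem blockedActivityClass_of_mesh_threshold (hρ : Continuous ρ) {C : ℝ}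
    (hC : ∀ (x : Fin 4 → ℤ) (i j : Fin 4) (U : LGConfig 4 G), |plaquetteObs ρ x i j U| ≤ C)
    (hb : 1 ≤ b) {a : ℝ} (ha2 : a ≤ 2)
    (hβ : (96 : ℝ) * (b : ℝ) ^ 4 * |β| * ((N : ℝ) + C) ≤ a / 2) (n : ℕ) : BlockedActivityClass ρ β b n a := by
  intro w hw Y _ h0
  have hA : ((96 * b ^ 4 : ℕ) : ℝ) * (|β| * ((N : ℝ) + C)) ≤ a / 2 :=
    calc ((96 * b ^ 4 : ℕ) : ℝ) * (|β| * ((N : ℝ) + C)) = 96 * (b : ℝ) ^ 4 * |β| * ((N : ℝ) + C) := by push_cast; ring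
      _ ≤ a / 2 := hβ
  exact nonempty_blockedRep_mesh ρ β hw hb hρ hC hA (by linarith) (by linarith) Y h0

/-- The same in the W-currency of record. -/
theorem blockedActivityClassW_of_mesh_threshold (hρ : Continuous ρ) {C : ℝ}
    (hC : ∀ (x : Fin 4 → ℤ) (i j : Fin 4) (U : LGConfig 4 G), |plaquetteObs ρ x i j U| ≤ C)
    (hb : 1 ≤ b) {a : ℝ} (ha2 : a ≤ 2)
    (hβ : (96 : ℝ) * (b : ℝ) ^ 4 * |β| * ((N : ℝ) + C) ≤ a / 2) (n : ℕ) : BlockedActivityClassW ρ β b n a :=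
  blockedActivityClassW_of_blockedActivityClass (blockedActivityClass_of_mesh_threshold ρ β hρ hC hb ha2 hβ n)

/-- **CALIBRATION AT EVERY MESH (existential window).**  For every compact `G`, continuous `ρ`, radius `a > 0` and mesh
`b ≥ 1` there is `β_B > 0` with `BlockedActivityClass ρ β b n a` for all `|β| ≤ β_B` and all windows `n`
(`β_B = min 1 (a/2) ∕ (96 b⁴ (N + C_ρ) + 1)`).  The case `b = 1` is `blockedActivityClass_one_of_smallBeta` (p531838). -/
theorem blockedActivityClass_of_smallBeta_mesh (hρ : Continuous ρ) {a : ℝ} (ha : 0 < a) (hb : 1 ≤ b) :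
    ∃ β_B : ℝ, 0 < β_B ∧ ∀ β : ℝ, |β| ≤ β_B → ∀ n : ℕ, BlockedActivityClass ρ β b n a := by
  obtain ⟨C, hC0, hC⟩ := exists_forall_abs_plaquetteObs_le (d := 4) ρ hρ
  set A : ℝ := min 1 (a / 2) with hAdef
  have hA0 : 0 < A := lt_min one_pos (by linarith)
  have hA1 : A ≤ 1 := min_le_left _ _
  have hAa : 2 * A ≤ a := by have := min_le_right 1 (a / 2); linarith
  set K : ℝ := ((96 * b ^ 4 : ℕ) : ℝ) * ((N : ℝ) + C) with hKdef
  have hK0 : 0 ≤ K := by positivity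
  refine ⟨A / (K + 1), div_pos hA0 (by linarith), fun β hβ n w hw Y _ h0 => ?_⟩
  have hβA : ((96 * b ^ 4 : ℕ) : ℝ) * (|β| * ((N : ℝ) + C)) ≤ A := by
    have h1 : ((96 * b ^ 4 : ℕ) : ℝ) * (|β| * ((N : ℝ) + C)) = K * |β| := by rw [hKdef]; ring
    rw [h1]
    calc K * |β| ≤ K * (A / (K + 1)) := mul_le_mul_of_nonneg_left hβ hK0
      _ = A * (K / (K + 1)) := by ring
      _ ≤ A * 1 := mul_le_mul_of_nonneg_left ((div_le_one (by linarith)).2 (by linarith)) hA0.le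
      _ = A := mul_one A
  exact nonempty_blockedRep_mesh ρ β hw hb hρ hC hβA hA1 hAa Y h0

/-- **THE NUMBER §A‴ (3) «strong end» AT EVERY MESH, W-currency of record**: for every `a > 0` and `b ≥ 1` there is
`β_B > 0` with `BlockedActivityClassW ρ β b n a` for all `|β| ≤ β_B` and all `n`.  The class of record is INHABITED at every
mesh the weak-side statements quantify over (inside a mesh-dependent strong window). -/
theorem blockedActivityClassW_of_smallBeta_mesh (hρ : Continuous ρ) {a : ℝ} (ha : 0 < a) (hb : 1 ≤ b) :
    ∃ β_B : ℝ, 0 < β_B ∧ ∀ β : ℝ, |β| ≤ β_B → ∀ n : ℕ, BlockedActivityClassW ρ β b n a := by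
  obtain ⟨β_B, hB, h⟩ := blockedActivityClass_of_smallBeta_mesh ρ hρ ha hb
  exact ⟨β_B, hB, fun β hβ n => blockedActivityClassW_of_blockedActivityClass (h β hβ n)⟩

/-- **ONE CONSTANT FOR ALL MESHES — `|β| · b⁴ ≤ κ`.**  For every compact `G`, continuous `ρ` and `a > 0` there is `κ > 0`
(`κ = min 1 (a/2) ∕ (96 (N + C_ρ) + 1)`) such that `|β| · b⁴ ≤ κ` puts the Wilson kernels in `BlockedActivityClassW ρ β b n a`
at every mesh `b ≥ 1` and every window `n`.  This is the rate at which the strong window of the class of record closes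
under re-indexing. -/
theorem blockedActivityClassW_of_beta_mul_pow_four_le (hρ : Continuous ρ) {a : ℝ} (ha : 0 < a) :
    ∃ κ : ℝ, 0 < κ ∧ ∀ b : ℕ, 1 ≤ b → ∀ β : ℝ, |β| * (b : ℝ) ^ 4 ≤ κ → ∀ n : ℕ, BlockedActivityClassW ρ β b n a := by
  obtain ⟨C, hC0, hC⟩ := exists_forall_abs_plaquetteObs_le (d := 4) ρ hρ
  set A : ℝ := min 1 (a / 2) with hAdef
  have hA0 : 0 < A := lt_min one_pos (by linarith)
  have hA1 : A ≤ 1 := min_le_left _ _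
  have hAa : 2 * A ≤ a := by have := min_le_right 1 (a / 2); linarith
  set K : ℝ := (96 : ℝ) * ((N : ℝ) + C) with hKdef
  have hK0 : 0 ≤ K := by positivity
  refine ⟨A / (K + 1), div_pos hA0 (by linarith), fun b hb β hβ n w hw Y _ h0 τ => ?_⟩
  have hβA : ((96 * b ^ 4 : ℕ) : ℝ) * (|β| * ((N : ℝ) + C)) ≤ A := by
    have h1 : ((96 * b ^ 4 : ℕ) : ℝ) * (|β| * ((N : ℝ) + C)) = K * (|β| * (b : ℝ) ^ 4) := by
      rw [hKdef]; push_cast; ring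
    rw [h1]
    calc K * (|β| * (b : ℝ) ^ 4) ≤ K * (A / (K + 1)) := mul_le_mul_of_nonneg_left hβ hK0
      _ = A * (K / (K + 1)) := by ring
      _ ≤ A * 1 := mul_le_mul_of_nonneg_left ((div_le_one (by linarith)).2 (by linarith)) hA0.le
      _ = A := mul_one A
  obtain ⟨R⟩ := nonempty_blockedRep_mesh ρ β hw hb hρ hC hβA hA1 hAa Y h0
  exact ⟨blockedRepOn_of_blockedRep R _⟩

/-- **Strong coupling, EVERY mesh and window.**  For every compact `G`, continuous `ρ` and `0 < ε ≤ 1` there is `κ > 0` with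
`OnsetFormats.UnivShellCond ρ β b n ε` for every mesh `b ≥ 1`, every `|β| · b⁴ ≤ κ` and every window `n` (the class at the
KP-grade radius `radiusKP ε` + the lane's reduction `univShellCond_of_blockedActivityW_sharp`, p538158). -/
theorem univShellCond_of_smallBeta_mesh (hρ : Continuous ρ) {ε : ℝ} (hε : 0 < ε) (hε1 : ε ≤ 1) :
    ∃ κ : ℝ, 0 < κ ∧ ∀ b : ℕ, 1 ≤ b → ∀ β : ℝ, |β| * (b : ℝ) ^ 4 ≤ κ → ∀ n : ℕ, UnivShellCond ρ β b n ε := by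
  obtain ⟨κ, hκ, h⟩ := blockedActivityClassW_of_beta_mul_pow_four_le ρ hρ (radiusKP_pos hε)
  exact ⟨κ, hκ, fun b hb β hβ n => univShellCond_of_blockedActivityW_sharp (h b hb β hβ n) hε1 le_rfl⟩

end Construction

end Summit.QuantumFields.YangMills.Cruxes.IR.BlockedActivity

end
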